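import Literature.Computability.AlgebraicComplexity.KoszulFlatteningBorderRank
import Literature.Computability.AlgebraicComplexity.CwSquareKoszulCert
import Literature.Computability.AlgebraicComplexity.BorderRankFlattening
import Literature.Computability.AlgebraicComplexity.BorderRankRestriction
import Literature.Computability.AlgebraicComplexity.OneOneOneCertificate
import Literature.LinearAlgebra.Matrix.IntRowCertificateUnitPivot
import HarnessLib

/-!
# Integer certificates for Koszul–Young (`p = 1`) and flattening LOWER bounds on border rank, checked by `decide`

Topic `Literature/Computability/AlgebraicComplexity`; a trunk-independent TOOL, the lower-bound
companion of `ApproxDecompositionCertificate.lean` (which certifies `bR(T) ≤ r` by an explicit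
approximate decomposition).  Everything here is PROVED; nothing is specific to one tensor.
HONEST FRAMING: the value is DECIDABLE VERDICTS / CERTIFICATES about explicit small tensors (the rows
of the certificate tables that import this file), not progress on the exponent of matrix
multiplication.

Two classical lower bounds for the border rank `bR(T)` of `T ∈ K^a ⊗ K^b ⊗ K^c` are packaged as closed
Boolean computations over `ℤ` on row/column CODES, so that `decide` / `decide +kernel` checks them and
a soundness theorem transports the check to `R ≤ algBorderRank (T ⊗ K)`:

* the **Koszul–Young flattening** with `p = 1` (Landsberg–Ottaviani): for a linear map
  `Φ : K^a → A' = K³` (an integer `3 × a` matrix `M`, "restriction/projection of the first factor"),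
  `T_Φ^{∧1} : A' ⊗ (K^b)^* → Λ²A' ⊗ K^c` has `rank ≤ C(2,1) · bR(T) = 2 · bR(T)`
  (tree theorem `le_algBorderRank_of_lt_rank_koszulFlattening`, `KoszulFlatteningBorderRank.lean`;
  Landsberg–Ottaviani 2015, Thm. 2.1, in the form quoted by Conner–Gesmundo–Landsberg–Ventura 2022,
  §3, eq. (8)); `KYCert.kyEntry a b c M T r q` is the entry of this `3c × 3b` integer matrix at row
  code `r = 𝑐·(pair no.) + l` and column code `q = b·(singleton no.) + j` (pairs `{0,1},{0,2},{1,2}`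
  and singletons `{0},{1},{2}` numbered as in `CGLVThm33.pairOf` / `singOf`), `KYCert.kyEntry_eq`
  identifies it with the tree's `koszulFlattening 1 (M.mulVecLin) T`, and
  `KYCert.le_algBorderRank_of_kyCheck` says: an integer row certificate (`intTriCheck`,
  `LinearAlgebra/Matrix/IntRowCertificate.lean`) for `rank ≥ n` with `2 (R - 1) < n` gives
  `R ≤ bR(T ⊗ K)` for every field `K` of characteristic zero (`…Unit`: unit pivots, every field);
* the **flattening** (slice) bound: `n` linearly independent slices `T(i_x, ·, ·)` give `n ≤ bR(T)`
  (Bläser 2013, Lemma 7.1(2) (proof) with Thm. 6.3(1); tree theorems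
  `card_le_algBorderRank_of_linearIndependent`, `algBorderRank_precomp_le`);
  `KYCert.sliceEntry n a b c sel T` is the `n × bc` matrix of the selected slices `sel`, and
  `KYCert.le_algBorderRank_of_sliceCheck(Unit)` transports a row certificate to `n ≤ bR(T ⊗ K)`.

The other two choices of the distinguished factor are reached through `algBorderRank_rotate`
(`KYCert.le_algBorderRank_of_rotate₁/₂`: a bound certified for the rotated integer tensor
`fun j l i => T i j l` or `fun l i j => T i j l` is a bound for `T`).  For `p = 1`, `dim A' = 3`,
exchanging the two undistinguished factors transposes the Koszul flattening up to signs
(`Λ¹A' ≅ (Λ²A')^*`), so three arrangements exhaust the method.  Certificates (the matrix `M`, the row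
combinations and pivots) are found outside Lean by exact elimination over `ℚ`; only their
verification is in the kernel.  Clients: the border-rank certificate tables of the pub-tensor bundle
(`SmallTensorBorderRankTable*.lean`).

## References

* J. M. Landsberg, G. Ottaviani, *New lower bounds for the border rank of matrix multiplication*,
  Theory of Computing 11 (2015) 285–298, Thm. 2.1 (Koszul flattenings; `p = 1`, `dim A' = 3`).
  [LandsbergOttaviani2015]
* A. Conner, F. Gesmundo, J. M. Landsberg, E. Ventura, *Rank and border rank of Kronecker powers of
  tensors and Strassen's laser method*, comput. complexity 31 (2022), §3, eq. (8)
  (`bR(T) ≥ rank(T_A^{∧p}) / C(2p,p)` after restriction to `A' = K^{2p+1}`).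
  [ConnerGesmundoLandsbergVentura2022]
* M. Bläser, *Fast Matrix Multiplication*, Theory of Computing Graduate Surveys 5 (2013), Def. 6.1,
  Thm. 6.3(1), Lemma 7.1(2). [Blaser2013]
-/

open scoped BigOperators Matrix
open Matrix

namespace Literature.Computability.AlgebraicComplexity

open Literature.LinearAlgebra.Matrix

universe u

namespace KYCert

/-! ## List arithmetic on codes -/

/-- `∑_{i<n} f i` as a list sum (kernel-evaluable). [folklore] -/
def lsum (n : ℕ) (f : ℕ → ℤ) : ℤ := ((List.range n).map f).sum

/-- `lsum (n+1) f = lsum n f + f n`. [folklore] -/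
theorem lsum_succ (n : ℕ) (f : ℕ → ℤ) : lsum (n + 1) f = lsum n f + f n := by
  simp [lsum, List.range_succ, List.map_append, List.sum_append]

/-- The list sum is the `Fin n`-indexed sum. [folklore] -/
theorem lsum_eq (n : ℕ) (f : ℕ → ℤ) : lsum n f = ∑ i : Fin n, f i := by
  induction n with
  | zero => simp [lsum]
  | succ n ih => rw [lsum_succ, Fin.sum_univ_castSucc, ih]; simp

/-- Entry `(x, i)` of an integer matrix given as a list of rows (`0` out of range). [folklore] -/
def mget (M : List (List ℤ)) (x i : ℕ) : ℤ := (M.getD x []).getD i 0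

/-- The `3 × a` integer matrix of a list of rows: the restriction map `Φ : K^a → A' = K³` of the
Koszul–Young flattening, in coordinates. [cite: ConnerGesmundoLandsbergVentura2022, §3] -/
def mat (a : ℕ) (M : List (List ℤ)) : Matrix (Fin 3) (Fin a) ℤ := Matrix.of fun x i => mget M x i

/-! ## The `p = 1` Koszul–Young flattening on codes -/

/-- Row decoder: code `r ↦ (pair no. r / c, third index r % c)`. [folklore] -/
def rowDec (c : ℕ) [NeZero c] (r : ℕ) : PSub 3 2 × Fin c :=
  (CGLVThm33.pairOf (finCode 3 (r / c)), finCode c r)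

/-- Column decoder: code `q ↦ (singleton no. q / b, second index q % b)`. [folklore] -/
def colDec (b : ℕ) [NeZero b] (q : ℕ) : PSub 3 1 × Fin b :=
  (CGLVThm33.singOf (finCode 3 (q / b)), finCode b q)

/-- Entry `(r, q)` of the integer `p = 1` Koszul–Young flattening `T_Φ^{∧1}` on codes:
`∑_{x<3} ε(pair r/c, singleton q/b, x) · ∑_{i<a} M[x][i] · T i (q % b) (r % c)`.
[cite: LandsbergOttaviani2015, Thm. 2.1] -/
def kyEntry (a b c : ℕ) [NeZero a] [NeZero b] [NeZero c] (M : List (List ℤ))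
    (T : Fin a → Fin b → Fin c → ℤ) (r q : ℕ) : ℤ :=
  lsum 3 fun x => CGLVThm33.incZ (r / c % 3) (q / b % 3) x *
    lsum a fun i => mget M x i * T (finCode a i) (finCode b q) (finCode c r)

/-- The code matrix IS the tree's Koszul flattening `koszulFlattening 1 (M.mulVecLin) T` (over `ℤ`),
read through the decoders. [cite: LandsbergGCT2017, §2.4.2 (2.4.6)] -/
theorem kyEntry_eq (a b c : ℕ) [NeZero a] [NeZero b] [NeZero c] (M : List (List ℤ))
    (T : Fin a → Fin b → Fin c → ℤ) (r q : ℕ) :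
    kyEntry a b c M T r q = koszulFlattening 1 (mat a M).mulVecLin T (rowDec c r) (colDec b q) := by
  have hf : ∀ i : Fin a, finCode a (i : ℕ) = i := fun i => Fin.ext (Nat.mod_eq_of_lt i.isLt)
  have hinc : ∀ x : Fin 3, CGLVThm33.incZ (r / c % 3) (q / b % 3) x =
      (if x ∉ (CGLVThm33.singOf (finCode 3 (q / b))).1 ∧
          (CGLVThm33.pairOf (finCode 3 (r / c))).1 = insert x (CGLVThm33.singOf (finCode 3 (q / b))).1
        then koszulSign (CGLVThm33.singOf (finCode 3 (q / b))).1 x else 0) :=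
    fun x => CGLVThm33.incZ_eq x (finCode 3 (r / c)) (finCode 3 (q / b))
  rw [koszulFlattening_apply, wedgeMatrix_apply]
  simp only [kyEntry, lsum_eq, rowDec, colDec, Matrix.mulVecLin_apply, Matrix.mulVec, dotProduct,
    mat, Matrix.of_apply, hf, Int.cast_id, hinc]
  refine Finset.sum_congr rfl fun x _ => ?_
  split_ifs <;> simp

/-! ## Soundness: a row certificate for the Koszul–Young flattening bounds the border rank -/

/-- **Koszul–Young certificate ⇒ `R ≤ bR`**, characteristic zero: if `n` rows of the integer `p = 1`
Koszul–Young flattening of `T` (restricted along the `3 × a` matrix `M`) are certified independent and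
`2 (R - 1) < n`, then `R ≤ bR(T ⊗ K)` (`rank ≤ C(2,1) · bR`).
[cite: LandsbergOttaviani2015, Thm. 2.1][cite: ConnerGesmundoLandsbergVentura2022, §3 eq. (8)] -/
theorem le_algBorderRank_of_kyCheck (K : Type u) [Field K] [CharZero K] {a b c : ℕ} [NeZero a]
    [NeZero b] [NeZero c] (M : List (List ℤ)) (T : Fin a → Fin b → Fin c → ℤ) {n R : ℕ}
    {rows : List (List (ℕ × ℤ))} {piv : List ℕ}
    (h : intTriCheck n (kyEntry a b c M T) rows piv = true) (hR : 2 * (R - 1) < n) :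
    R ≤ algBorderRank (fun i j l => (T i j l : K)) := by
  have e : kyEntry a b c M T =
      fun r q => koszulFlattening 1 (mat a M).mulVecLin T (rowDec c r) (colDec b q) :=
    funext fun r => funext fun q => kyEntry_eq a b c M T r q
  rw [e] at h
  have hr := le_rank_of_intTriCheck (F := K) (koszulFlattening 1 (mat a M).mulVecLin T)
    (rowDec c) (colDec b) h
  have hm : (koszulFlattening 1 (mat a M).mulVecLin T).map (Int.cast : ℤ → K) =
      koszulFlattening 1 ((mat a M).map (Int.cast : ℤ → K)).mulVecLin (fun i j l => (T i j l : K)) :=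
    koszulFlattening_mulVecLin_map (Int.castRingHom K) 1 (mat a M) T
  rw [hm] at hr
  refine le_algBorderRank_of_lt_rank_koszulFlattening 1 ((mat a M).map (Int.cast : ℤ → K)) _ ?_
  have h2 : (2 * 1).choose 1 = 2 := by decide
  rw [h2]
  omega

/-- **Koszul–Young certificate ⇒ `R ≤ bR`**, every field: the same with UNIT pivots
(`intTriCheckUnit`), so that the certified rank bound holds in every characteristic.
[cite: LandsbergOttaviani2015, Thm. 2.1][cite: ConnerGesmundoLandsbergVentura2022, §3 eq. (8)] -/
theorem le_algBorderRank_of_kyCheckUnit (K : Type u) [Field K] {a b c : ℕ} [NeZero a]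
    [NeZero b] [NeZero c] (M : List (List ℤ)) (T : Fin a → Fin b → Fin c → ℤ) {n R : ℕ}
    {rows : List (List (ℕ × ℤ))} {piv : List ℕ}
    (h : intTriCheckUnit n (kyEntry a b c M T) rows piv = true) (hR : 2 * (R - 1) < n) :
    R ≤ algBorderRank (fun i j l => (T i j l : K)) := by
  have e : kyEntry a b c M T =
      fun r q => koszulFlattening 1 (mat a M).mulVecLin T (rowDec c r) (colDec b q) :=
    funext fun r => funext fun q => kyEntry_eq a b c M T r q
  rw [e] at h
  have hr := le_rank_of_intTriCheckUnit (F := K) (koszulFlattening 1 (mat a M).mulVecLin T)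
    (rowDec c) (colDec b) h
  have hm : (koszulFlattening 1 (mat a M).mulVecLin T).map (Int.cast : ℤ → K) =
      koszulFlattening 1 ((mat a M).map (Int.cast : ℤ → K)).mulVecLin (fun i j l => (T i j l : K)) :=
    koszulFlattening_mulVecLin_map (Int.castRingHom K) 1 (mat a M) T
  rw [hm] at hr
  refine le_algBorderRank_of_lt_rank_koszulFlattening 1 ((mat a M).map (Int.cast : ℤ → K)) _ ?_
  have h2 : (2 * 1).choose 1 = 2 := by decide
  rw [h2]
  omega

/-! ## The flattening (selected slices) certificate -/

/-- Column decoder of the first flattening for format `· × b × c`: code `q ↦ (q / c, q % c)`.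
[folklore] -/
def slabDec (b c : ℕ) [NeZero b] [NeZero c] (q : ℕ) : Fin b × Fin c := (finCode b (q / c), finCode c q)

/-- Entry `(x, q)` of the matrix of the `n` selected slices `T(sel[x], ·, ·)` (`x` read mod `n`) on
codes. [cite: Blaser2013, Lemma 7.1(2) (proof)] -/
def sliceEntry (n a b c : ℕ) [NeZero n] [NeZero a] [NeZero b] [NeZero c] (sel : List ℕ)
    (T : Fin a → Fin b → Fin c → ℤ) (x q : ℕ) : ℤ :=
  T (finCode a (sel.getD (x % n) 0)) (finCode b (q / c)) (finCode c q)

/-- **Slice certificate ⇒ `n ≤ bR`**, characteristic zero: `n` selected slices of `T` along the first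
factor certified linearly independent give `n ≤ bR(T ⊗ K)` (restrict to the selected coordinates,
`algBorderRank_precomp_le`, then conciseness, `card_le_algBorderRank_of_linearIndependent`).
[cite: Blaser2013, Lemma 7.1(2) (proof) and Thm. 6.3(1)] -/
theorem le_algBorderRank_of_sliceCheck (K : Type u) [Field K] [CharZero K] (n : ℕ) [NeZero n]
    {a b c : ℕ} [NeZero a] [NeZero b] [NeZero c] (sel : List ℕ) (T : Fin a → Fin b → Fin c → ℤ)
    {rows : List (List (ℕ × ℤ))} {piv : List ℕ}
    (h : intTriCheck n (sliceEntry n a b c sel T) rows piv = true) :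
    n ≤ algBorderRank (fun i j l => (T i j l : K)) := by
  have e : sliceEntry n a b c sel T = fun x q =>
      slab₁ (fun (x : Fin n) j l => T (finCode a (sel.getD x 0)) j l) (finCode n x) (slabDec b c q) :=
    rfl
  rw [e] at h
  have hr := le_rank_of_intTriCheck (F := K)
    (slab₁ fun (x : Fin n) j l => T (finCode a (sel.getD x 0)) j l) (finCode n) (slabDec b c) h
  have em : (slab₁ fun (x : Fin n) j l => T (finCode a (sel.getD x 0)) j l).map (Int.cast : ℤ → K) =
      slab₁ (fun (x : Fin n) j l => (T (finCode a (sel.getD x 0)) j l : K)) := rfl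
  rw [em] at hr
  have hli := linearIndependent_of_card_le_rank_slab₁ (K := K)
    (fun (x : Fin n) j l => (T (finCode a (sel.getD x 0)) j l : K)) (by simpa using hr)
  have h1 := card_le_algBorderRank_of_linearIndependent _ hli
  rw [Fintype.card_fin] at h1
  exact h1.trans (algBorderRank_precomp_le (fun i j l => (T i j l : K))
    (fun x : Fin n => finCode a (sel.getD x 0)) (fun j => j) (fun l => l))

/-- **Slice certificate ⇒ `n ≤ bR`**, every field (unit pivots).
[cite: Blaser2013, Lemma 7.1(2) (proof) and Thm. 6.3(1)] -/
theorem le_algBorderRank_of_sliceCheckUnit (K : Type u) [Field K] (n : ℕ) [NeZero n]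
    {a b c : ℕ} [NeZero a] [NeZero b] [NeZero c] (sel : List ℕ) (T : Fin a → Fin b → Fin c → ℤ)
    {rows : List (List (ℕ × ℤ))} {piv : List ℕ}
    (h : intTriCheckUnit n (sliceEntry n a b c sel T) rows piv = true) :
    n ≤ algBorderRank (fun i j l => (T i j l : K)) := by
  have e : sliceEntry n a b c sel T = fun x q =>
      slab₁ (fun (x : Fin n) j l => T (finCode a (sel.getD x 0)) j l) (finCode n x) (slabDec b c q) :=
    rfl
  rw [e] at h
  have hr := le_rank_of_intTriCheckUnit (F := K)
    (slab₁ fun (x : Fin n) j l => T (finCode a (sel.getD x 0)) j l) (finCode n) (slabDec b c) h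
  have em : (slab₁ fun (x : Fin n) j l => T (finCode a (sel.getD x 0)) j l).map (Int.cast : ℤ → K) =
      slab₁ (fun (x : Fin n) j l => (T (finCode a (sel.getD x 0)) j l : K)) := rfl
  rw [em] at hr
  have hli := linearIndependent_of_card_le_rank_slab₁ (K := K)
    (fun (x : Fin n) j l => (T (finCode a (sel.getD x 0)) j l : K)) (by simpa using hr)
  have h1 := card_le_algBorderRank_of_linearIndependent _ hli
  rw [Fintype.card_fin] at h1
  exact h1.trans (algBorderRank_precomp_le (fun i j l => (T i j l : K))
    (fun x : Fin n => finCode a (sel.getD x 0)) (fun j => j) (fun l => l))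

/-! ## The other two distinguished factors -/

/-- A bound certified for the rotated tensor `(j, l, i) ↦ T i j l` (second factor distinguished) is a
bound for `T` (`algBorderRank_rotate`). [cite: Blaser2013, §5.1 (permutation of tensors)] -/
theorem le_algBorderRank_of_rotate₁ (K : Type u) [Field K] {a b c : ℕ}
    (T : Fin a → Fin b → Fin c → ℤ) {R : ℕ} (h : R ≤ algBorderRank (fun j l i => (T i j l : K))) :
    R ≤ algBorderRank (fun i j l => (T i j l : K)) := by
  rw [← algBorderRank_rotate (fun i j l => (T i j l : K))]
  exact h

/-- A bound certified for the rotated tensor `(l, i, j) ↦ T i j l` (third factor distinguished) is a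
bound for `T` (`algBorderRank_rotate`, twice). [cite: Blaser2013, §5.1 (permutation of tensors)] -/
theorem le_algBorderRank_of_rotate₂ (K : Type u) [Field K] {a b c : ℕ}
    (T : Fin a → Fin b → Fin c → ℤ) {R : ℕ} (h : R ≤ algBorderRank (fun l i j => (T i j l : K))) :
    R ≤ algBorderRank (fun i j l => (T i j l : K)) := by
  rw [← algBorderRank_rotate (fun i j l => (T i j l : K)), ← algBorderRank_rotate]
  exact h

end KYCert

end Literature.Computability.AlgebraicComplexity
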